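import Summits.QuantumFields.YangMills.Theorems.AlphaInputsT3ACv3AbelianLocal
import Summits.QuantumFields.YangMills.Theorems.UnitScaleTiltProp7FlatHolonomy
import Literature.MathematicalPhysics.QuantumFieldTheory.Balaban1983to89.B10Eq38TorusDomains
import HarnessLib

/-!
# `AlphaInputsT3ACv3AbelianLiftAvg` — STRATEGY B for 2′, toward (FL) for abelian data via (LL): THE `k`-FOLD (0.4) LINEAR AVERAGE IN CLOSED FORM — linearity,
# exact one-forms average to exact one-forms (`linAvgIter s (δφ) = δ(φ ∘ toFine s)`), and `linAvgIter k a = L^{−kd}·(tube sum) − (coboundary)` — lane `pub-balaban3d`,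
# seat alpha-2 (g5)

WHY (HOME `D6R-SEAMS-alpha2-g4.md` §7; OWNER DEPMAP v3.3).  The displayed W-dependent kinematic row of 2′ is (FL) `InnerFineLiftsT3`; for ABELIAN data it is reduced
(`…v3AbelianFineLift.fineLift_of_linearLift_abelian`) to (LL): a finest one-form `a` with EXACT `k`-fold linear (0.4)-averages `linAvgIter k a = A` on the bonds of a
region and small curls under it.  The construction of such an `a` (sibling files of this seat) needs the averaging functional in closed form.  THIS FILE (generic torus
`P`, any `d`): §1 `linAvg04`/`linAvgIter` are additive; §2 the COBOUNDARY `cobd φ` of a site function (`φ(b₊) − φ(b₋)`): its walk sums telescope, its (0.4) loop sums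
vanish, so ★ `linAvg04 (cobd φ) = cobd (φ ∘ emb)` and `linAvgIter s (cobd φ) = cobd (φ ∘ toFine s)`; its curls vanish; §3 the TUBE SUM `tubeSum k a c =
Σ_{z ∈ B^k(c₋)} Σ_{t<L^k} a(z + t e_μ, μ)` over the level-`k` block (offset parametrisation `bsite`), the one-level form of g3's `segMean` (`segMean_eq_tubeSum_one`) and the
composition of tubes (`tubeSum_succ`); §4 ★★ `linAvgIter_eq_tubeSum_sub_cobd`: `linAvgIter k a = (L^k)^{−d}·tubeSum k a − cobd Φ` for some site function `Φ` (induction on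
g3's `linAvg04_eq`: the staircase means form a coboundary, the segment mean of a coboundary is the coboundary of the block mean).
HONEST FRAMING.  Kernel bookkeeping of the linear (0.4) average; nothing of [B10]∕[7]∕[4] asserted; count-neutral helper toward R3 2′ (`stub_laneRecordsV3`, items
19935∕19936); registry untouched; nothing about d = 4, the continuum, or a mass gap.

References: T. Bałaban, Commun. Math. Phys. 109 (1987) 249–301 [Balaban1987RG1] ((0.3)–(0.4) pp.252–253, (0.11) p.253); CMP 98 (1985) 17–51 [Balaban1985Averaging]
((14) p.19).
-/

set_option autoImplicit false

noncomputable section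

namespace Summit.QuantumFields.YangMills.Theorems.AbelianEML

open scoped BigOperators
open Literature.MathematicalPhysics.QuantumFieldTheory.Balaban1983to89
open Literature.MathematicalPhysics.QuantumFieldTheory.Balaban1983to89.T4Continuum
open Literature.MathematicalPhysics.QuantumFieldTheory.Balaban1983to89.BlockAveraging (off Idx)
open Literature.MathematicalPhysics.QuantumFieldTheory.Balaban1983to89.BlockAveragingEMLProp2 (walkEnd_replicate_true shiftN_apply shift_shift_comm)
open Literature.MathematicalPhysics.QuantumFieldTheory.Balaban1983to89.B10Eq47AxialChi (shiftN shiftN_zero shiftN_succ)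
open Literature.MathematicalPhysics.QuantumFieldTheory.Balaban1983to89.B10Eq38TorusDomains (toFine toFine_zero toFine_succ)
open Summit.QuantumFields.YangMills.Theorems.Prop7FlatHolonomy (sitesPerDir_zero_eq_mul_pow)

variable {P : Params} {j : ℕ}

/-! ## §1 Additivity of the linear averages -/

/-- Walk sums are additive in the one-form. [folklore] -/
theorem wsum_add (a b : PBond P j → ℝ) : ∀ (w : List (Letter P.d)) (x : Site P j), wsum (a + b) x w = wsum a x w + wsum b x w
  | [], x => by simp
  | (μ, true) :: w, x => by rw [wsum_cons_true, wsum_cons_true, wsum_cons_true, wsum_add a b w, Pi.add_apply]; ring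
  | (μ, false) :: w, x => by rw [wsum_cons_false, wsum_cons_false, wsum_cons_false, wsum_add a b w, Pi.add_apply]; ring

/-- **The (0.4) linear average is additive.** [cite: Balaban1987RG1, (0.4) p.253] -/
theorem linAvg04_add (a b : PBond P j → ℝ) : linAvg04 (a + b) = linAvg04 a + linAvg04 b := by
  funext c
  simp only [Pi.add_apply, linAvg04, loopSum, axialSum, wsum_add, Finset.sum_add_distrib]
  ring

/-- The iterated linear average is additive. [cite: Balaban1987RG1, (0.11) p.253] -/
theorem linAvgIter_add : ∀ (s : ℕ) (a b : PBond P 0 → ℝ), linAvgIter s (a + b) = linAvgIter s a + linAvgIter s b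
  | 0, _, _ => rfl
  | s + 1, a, b => by rw [linAvgIter_succ, linAvgIter_succ, linAvgIter_succ, linAvgIter_add s, linAvg04_add]

/-! ## §2 Coboundaries: exact one-forms average to exact one-forms, and have no curl -/

/-- **THE COBOUNDARY OF A SITE FUNCTION**: the one-form `b ↦ φ(b₊) − φ(b₋)`. [cite: Balaban1985Averaging, (8) p.19] -/
def cobd (φ : Site P j → ℝ) : PBond P j → ℝ := fun b => φ b.tgt - φ b.src

/-- `cobd` unfolded at a bond. [folklore] -/
@[simp] theorem cobd_apply (φ : Site P j → ℝ) (x : Site P j) (μ : Fin P.d) : cobd φ ⟨x, μ⟩ = φ (x.shift μ) - φ x := rfl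

/-- **Walk sums of a coboundary telescope**: `Σ_w (δφ) = φ(end) − φ(start)`. [folklore] -/
theorem wsum_cobd (φ : Site P j → ℝ) : ∀ (w : List (Letter P.d)) (x : Site P j), wsum (cobd φ) x w = φ (walkEnd x w) - φ x
  | [], x => by simp [walkEnd]
  | (μ, true) :: w, x => by rw [wsum_cons_true, wsum_cobd φ w]; simp only [walkEnd, cobd_apply]; ring
  | (μ, false) :: w, x => by
    rw [wsum_cons_false, wsum_cobd φ w]
    simp only [walkEnd, cobd, PBond.tgt, Site.shift_unshift]
    ring

/-- The staircase sum of a coboundary. [cite: Balaban1987RG1, (0.3) p.252] -/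
theorem stairSum_cobd (φ : Site P j → ℝ) (y : Site P (j + 1)) (n : Fin P.d → ℤ) (σ : Equiv.Perm (Fin P.d)) :
    stairSum (cobd φ) y n σ = φ (offPt y n) - φ (emb y) := by
  rw [stairSum, wsum_cobd, walkEnd_stairWord_offPt]

/-- The transported-segment sum of a coboundary. [cite: Balaban1987RG1, (0.4) p.253] -/
theorem segSum_cobd (φ : Site P j → ℝ) (y : Site P (j + 1)) (n : Fin P.d → ℤ) (μ : Fin P.d) :
    segSum (cobd φ) y n μ = φ (offPt (y.shift μ) n) - φ (offPt y n) := by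
  rw [segSum, wsum_cobd, ← offPt_shift]

/-- The axial sum of a coboundary. [cite: Balaban1985Averaging, (14) p.19] -/
theorem axialSum_cobd (φ : Site P j → ℝ) (c : PBond P (j + 1)) : axialSum (cobd φ) c = φ (emb c.tgt) - φ (emb c.src) := by
  rw [axialSum, wsum_cobd, walkEnd_axial]

/-- **The (0.4) loop sums of a coboundary vanish** (closed loops). [cite: Balaban1987RG1, (0.4) p.253] -/
theorem loopSum_cobd (φ : Site P j → ℝ) (c : PBond P (j + 1)) (i : Idx P) : loopSum (cobd φ) c i = 0 := by
  rw [loopSum_eq, stairSum_cobd, segSum_cobd, stairSum_cobd, axialSum_cobd]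
  simp only [PBond.tgt]
  ring

/-- **★ THE (0.4) LINEAR AVERAGE OF A COBOUNDARY IS THE COBOUNDARY OF THE RESTRICTION TO THE COARSE SITES**: `linAvg04 (δφ) = δ(φ ∘ emb)`. [cite: Balaban1987RG1, (0.4) p.253] -/
theorem linAvg04_cobd (φ : Site P j → ℝ) : linAvg04 (cobd φ) = cobd (φ ∘ emb) := by
  funext c
  simp only [linAvg04, loopSum_cobd, Finset.sum_const_zero, mul_zero, zero_add, axialSum_cobd, cobd, Function.comp]

/-- **The `s`-fold linear average of a finest coboundary is the coboundary of the restriction along `toFine s`.** [cite: Balaban1987RG1, (0.11) p.253] -/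
theorem linAvgIter_cobd : ∀ (s : ℕ) (φ : Site P 0 → ℝ), linAvgIter s (cobd φ) = cobd (φ ∘ toFine s)
  | 0, φ => by funext b; rfl
  | s + 1, φ => by rw [linAvgIter_succ, linAvgIter_cobd s φ, linAvg04_cobd]; rfl

/-- **Coboundaries have no curl.** [cite: Balaban1985Averaging, (9) p.19] -/
theorem curlAt_cobd (φ : Site P j → ℝ) (x : Site P j) (μ ν : Fin P.d) : curlAt (cobd φ) x μ ν = 0 := by
  simp only [curlAt, cobd_apply, shift_shift_comm x μ ν]
  ring

/-- Curls are additive in the one-form. [folklore] -/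
theorem curlAt_add (a b : PBond P j → ℝ) (x : Site P j) (μ ν : Fin P.d) : curlAt (a + b) x μ ν = curlAt a x μ ν + curlAt b x μ ν := by
  simp only [curlAt, Pi.add_apply]; ring

/-! ## §3 Tube sums over the level-`k` blocks -/

/-- **THE FINEST SITE OF THE LEVEL-`k` BLOCK OF `y` WITH OFFSET `r ∈ {0,…,L^k−1}^d`** (label `y·L^k + r` coordinatewise; `Site.blockSite` is the case `k = 1`). [cite: Balaban1987RG1, (0.3) p.252] -/
def bsite (k : ℕ) (y : Site P k) (r : Fin P.d → Fin (P.L ^ k)) : Site P 0 :=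
  fun i => (((y i).val * P.L ^ k + r i : ℕ) : ZMod (P.sitesPerDir 0))

/-- The label of `bsite k y r` is `y·L^k + r` (no wrap-around in the standing range). [folklore] -/
theorem val_bsite {k : ℕ} (hk : k ≤ P.m + P.K) (y : Site P k) (r : Fin P.d → Fin (P.L ^ k)) (i : Fin P.d) :
    ((bsite k y r) i).val = (y i).val * P.L ^ k + r i := by
  simp only [bsite]
  rw [ZMod.val_natCast, Nat.mod_eq_of_lt]
  have hy : (y i).val + 1 ≤ P.sitesPerDir k := ZMod.val_lt (y i)
  have h1 : ((y i).val + 1) * P.L ^ k ≤ P.sitesPerDir k * P.L ^ k := Nat.mul_le_mul_right _ hy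
  have h2 := (r i).isLt
  rw [sitesPerDir_zero_eq_mul_pow hk]
  rw [Nat.add_mul, one_mul] at h1
  omega

/-- At level `0` the block of `x` is `{x}`: `bsite 0 x r = x`. [folklore] -/
theorem bsite_zero (x : Site P 0) (r : Fin P.d → Fin (P.L ^ 0)) : bsite 0 x r = x := by
  funext i
  have hr : ((r i : ℕ)) = 0 := Nat.lt_one_iff.mp (lt_of_lt_of_eq (r i).isLt (pow_zero _))
  simp only [bsite, pow_zero, mul_one, hr, add_zero, ZMod.natCast_val, ZMod.cast_id', id_eq]

/-- **THE TUBE SUM** of a finest one-form at a level-`k` bond `c = (y, μ)`: `Σ_{z ∈ B^k(y)} Σ_{t < L^k} a(z + t e_μ, μ)` — the block is parametrised by offsets.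
[cite: Balaban1987RG1, (0.4) p.253] -/
def tubeSum (k : ℕ) (a : PBond P 0 → ℝ) (c : PBond P k) : ℝ :=
  ∑ r : Fin P.d → Fin (P.L ^ k), ∑ t : Fin (P.L ^ k), a ⟨shiftN (bsite k c.src r) c.dir t, c.dir⟩

/-- At level `0` the tube sum is the one-form itself. [folklore] -/
theorem tubeSum_zero (a : PBond P 0 → ℝ) (c : PBond P 0) : tubeSum 0 a c = a c := by
  unfold tubeSum
  have ht : ∀ t : Fin (P.L ^ 0), ((t : ℕ)) = 0 := fun t => Nat.lt_one_iff.mp (lt_of_lt_of_eq t.isLt (pow_zero _))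
  have h1 : ∀ (r : Fin P.d → Fin (P.L ^ 0)) (t : Fin (P.L ^ 0)), a ⟨shiftN (bsite 0 c.src r) c.dir t, c.dir⟩ = a c := by
    intro r t; rw [ht t, shiftN_zero, bsite_zero]
  simp only [h1, Finset.sum_const, Finset.card_univ, nsmul_eq_mul, Fintype.card_fun, Fintype.card_fin, pow_zero, one_pow, Nat.cast_one,
    one_mul]

/-- Iterated shifts add up. [folklore] -/
theorem shiftN_add (x : Site P j) (μ : Fin P.d) (m : ℕ) : ∀ n : ℕ, shiftN (shiftN x μ m) μ n = shiftN x μ (m + n)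
  | 0 => rfl
  | n + 1 => by rw [shiftN_succ, shiftN_add x μ m n, ← shiftN_succ]; rfl

/-- Sub-blocks: the offset `R = r′·L^k + r` of the level-`(k+1)` block of `y` is the offset `r` of the level-`k` block of `blockSite y r′` (standing range). [folklore] -/
theorem bsite_succ {k : ℕ} (hk : k + 1 ≤ P.m + P.K) (y : Site P (k + 1)) (r' : Fin P.d → Fin P.L) (r : Fin P.d → Fin (P.L ^ k)) :
    bsite k (Site.blockSite y r') r = bsite (k + 1) y (fun i => ⟨(r i : ℕ) + P.L ^ k * r' i, by
      have h1 := (r i).isLt; have h2 : (r' i : ℕ) + 1 ≤ P.L := (r' i).isLt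
      calc (r i : ℕ) + P.L ^ k * r' i < P.L ^ k + P.L ^ k * r' i := by omega
        _ = P.L ^ k * (r' i + 1) := by ring
        _ ≤ P.L ^ k * P.L := Nat.mul_le_mul_left _ h2
        _ = P.L ^ (k + 1) := by rw [pow_succ]⟩) := by
  funext i
  simp only [bsite]
  rw [Site.val_blockSite hk]
  push_cast
  ring

/-- A coarse shift by `t′` moves the level-`k` block sites by `t′·L^k` finest steps (as torus sites; standing range). [folklore] -/
theorem bsite_shiftN {k : ℕ} (hk : k ≤ P.m + P.K) (x : Site P k) (μ : Fin P.d) (t' : ℕ) (r : Fin P.d → Fin (P.L ^ k)) :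
    bsite k (shiftN x μ t') r = shiftN (bsite k x r) μ (t' * P.L ^ k) := by
  have hN0 := sitesPerDir_zero_eq_mul_pow hk
  funext i
  rw [shiftN_apply]
  simp only [bsite, shiftN_apply]
  by_cases h : i = μ
  · subst h
    simp only [if_true]
    rw [← Nat.cast_add, ZMod.natCast_eq_natCast_iff', hN0]
    have hw : (x i + ((t' : ℕ) : ZMod (P.sitesPerDir k))).val = ((x i).val + t') % P.sitesPerDir k := by
      rw [ZMod.val_add, ZMod.val_natCast, Nat.add_mod, Nat.mod_mod, ← Nat.add_mod]
    rw [hw]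
    set N := P.sitesPerDir k
    set v := (x i).val
    have hdm := Nat.mod_add_div (v + t') N
    have e1 : v * P.L ^ k + (r i : ℕ) + t' * P.L ^ k = ((v + t') % N + N * ((v + t') / N)) * P.L ^ k + (r i : ℕ) := by
      rw [hdm]; ring
    have e2 : ((v + t') % N + N * ((v + t') / N)) * P.L ^ k + (r i : ℕ) = (v + t') % N * P.L ^ k + (r i : ℕ) + N * P.L ^ k * ((v + t') / N) := by
      ring
    rw [e1, e2, Nat.add_mul_mod_self_left]
  · simp [h]

/-- **COMPOSITION OF TUBES**: the level-`(k+1)` tube sum is the sum over the `L^d` sub-blocks and the `L` coarse steps of the level-`k` tube sums (standing range).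
[cite: Balaban1987RG1, (0.11) p.253] -/
theorem tubeSum_succ {k : ℕ} (hk : k + 1 ≤ P.m + P.K) (a : PBond P 0 → ℝ) (c : PBond P (k + 1)) :
    tubeSum (k + 1) a c = ∑ r' : Fin P.d → Fin P.L, ∑ t' : Fin P.L, tubeSum k a ⟨shiftN (Site.blockSite c.src r') c.dir t', c.dir⟩ := by
  have hk' : k ≤ P.m + P.K := Nat.le_of_succ_le hk
  -- steps `u < L^{k+1}` ↔ `(t′, t)` with `u = t + L^k t′`; offsets of the big block ↔ (sub-block `r′`, offset `r`)
  let eT : Fin P.L × Fin (P.L ^ k) ≃ Fin (P.L ^ (k + 1)) := finProdFinEquiv.trans (finCongr (Nat.mul_comm _ _))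
  let eR : (Fin P.d → Fin P.L) × (Fin P.d → Fin (P.L ^ k)) ≃ (Fin P.d → Fin (P.L ^ (k + 1))) :=
    (Equiv.arrowProdEquivProdArrow _ _ _).symm.trans (Equiv.arrowCongr (Equiv.refl _) eT)
  have heT : ∀ (t' : Fin P.L) (t : Fin (P.L ^ k)), ((eT (t', t) : Fin (P.L ^ (k + 1))) : ℕ) = (t : ℕ) + P.L ^ k * (t' : ℕ) := fun _ _ => rfl
  unfold tubeSum
  rw [← Equiv.sum_comp eR, Fintype.sum_prod_type]
  refine Finset.sum_congr rfl fun r' _ => ?_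
  have inner : ∀ r : Fin P.d → Fin (P.L ^ k),
      ∑ t : Fin (P.L ^ (k + 1)), a ⟨shiftN (bsite (k + 1) c.src (eR (r', r))) c.dir t, c.dir⟩ =
        ∑ t' : Fin P.L, ∑ t : Fin (P.L ^ k), a ⟨shiftN (bsite k (shiftN (Site.blockSite c.src r') c.dir t') r) c.dir t, c.dir⟩ := by
    intro r
    rw [← Equiv.sum_comp eT, Fintype.sum_prod_type]
    refine Finset.sum_congr rfl fun t' _ => Finset.sum_congr rfl fun t _ => ?_
    have hR : bsite (k + 1) c.src (eR (r', r)) = bsite k (Site.blockSite c.src r') r := by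
      rw [bsite_succ hk]; rfl
    have hsum : (t' : ℕ) * P.L ^ k + (t : ℕ) = (t : ℕ) + P.L ^ k * (t' : ℕ) := by ring
    rw [hR, bsite_shiftN hk', shiftN_add, heT, hsum]
  simp only [inner]
  rw [Finset.sum_comm]

/-- The sum over the (0.4) index set of a function of the offset alone. [folklore] -/
theorem sum_idx_fst {α : Type*} [AddCommMonoid α] (f : (Fin P.d → Fin P.L) → α) :
    ∑ i : Idx P, f i.1 = (Fintype.card (Equiv.Perm (Fin P.d)) * Fintype.card (Equiv.Perm (Fin P.d))) • ∑ r : Fin P.d → Fin P.L, f r := by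
  rw [Fintype.sum_prod_type]
  simp only [Finset.sum_const, Finset.card_univ, Fintype.card_prod, Finset.smul_sum]

/-- `|Idx| = L^d · (d!)²`. [folklore] -/
theorem card_idx : Fintype.card (Idx P) = P.L ^ P.d * (Fintype.card (Equiv.Perm (Fin P.d)) * Fintype.card (Equiv.Perm (Fin P.d))) := by
  simp only [Idx, Fintype.card_prod, Fintype.card_fun, Fintype.card_fin]

/-- **THE TRANSPORTED-SEGMENT MEAN IS THE ONE-LEVEL TUBE SUM OVER `L^d`**: `segMean a c = L^{−d}·Σ_{x ∈ B(c₋)} Σ_{t<L} a(x + t e_μ, μ)`. [cite: Balaban1987RG1, (0.4) p.253] -/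
theorem segMean_eq (a : PBond P j → ℝ) (c : PBond P (j + 1)) :
    segMean a c = ((P.L : ℝ) ^ P.d)⁻¹ * ∑ r : Fin P.d → Fin P.L, runSum a (Site.blockSite c.src r) c.dir P.L := by
  unfold segMean
  have h1 : ∑ i : Idx P, segSum a c.src (off i.1) c.dir = ∑ i : Idx P, (fun r : Fin P.d → Fin P.L => runSum a (Site.blockSite c.src r) c.dir P.L) i.1 :=
    Finset.sum_congr rfl fun i _ => by simp only [segSum, wsum_replicate_true, offPt_off_eq_blockSite]
  have h2 := sum_idx_fst (P := P) (fun r : Fin P.d → Fin P.L => runSum a (Site.blockSite c.src r) c.dir P.L)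
  rw [h1, h2, card_idx, nsmul_eq_mul]
  have hc : (0 : ℝ) < (Fintype.card (Equiv.Perm (Fin P.d)) * Fintype.card (Equiv.Perm (Fin P.d)) : ℕ) := by
    have : 0 < Fintype.card (Equiv.Perm (Fin P.d)) := Fintype.card_pos
    positivity
  push_cast
  field_simp

/-! ## §4 The `k`-fold linear average in closed form -/

/-- **THE BLOCK MEAN** of a site function over the level-`1` blocks. [folklore] -/
def blockMean (φ : Site P j → ℝ) : Site P (j + 1) → ℝ := fun y => ((P.L : ℝ) ^ P.d)⁻¹ * ∑ r : Fin P.d → Fin P.L, φ (Site.blockSite y r)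

/-- **The segment mean of a coboundary is the coboundary of the block mean.** [cite: Balaban1987RG1, (0.4) p.253] -/
theorem segMean_cobd (φ : Site P j → ℝ) (c : PBond P (j + 1)) : segMean (cobd φ) c = cobd (blockMean φ) c := by
  rw [segMean_eq]
  simp only [cobd, blockMean, PBond.tgt, ← wsum_replicate_true, wsum_cobd, walkEnd_replicate_true, Finset.sum_sub_distrib, mul_sub]
  congr 2
  refine Finset.sum_congr rfl fun r _ => ?_
  rw [← offPt_off_eq_blockSite, ← offPt_off_eq_blockSite, offPt_shift, walkEnd_replicate_true]

/-- `segMean` is additive. [folklore] -/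
theorem segMean_add (a b : PBond P j → ℝ) (c : PBond P (j + 1)) : segMean (a + b) c = segMean a c + segMean b c := by
  simp only [segMean, segSum, wsum_add, Finset.sum_add_distrib, mul_add]

/-- `segMean` of a scalar multiple. [folklore] -/
theorem segMean_smul (s : ℝ) (a : PBond P j → ℝ) (c : PBond P (j + 1)) : segMean (fun b => s * a b) c = s * segMean a c := by
  simp only [segMean, segSum, wsum_smul, ← Finset.mul_sum]; ring

/-- `segMean` of a negated coboundary plus a form (bookkeeping form used in the induction). [folklore] -/
theorem segMean_sub_cobd (a : PBond P j → ℝ) (φ : Site P j → ℝ) (c : PBond P (j + 1)) :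
    segMean (a - cobd φ) c = segMean a c - cobd (blockMean φ) c := by
  have h : a - cobd φ = a + (fun b => (-1 : ℝ) * cobd φ b) := by funext b; simp; ring
  rw [h, segMean_add, segMean_smul, segMean_cobd]; ring

/-- **The segment mean of the level-`k` tube sum (read as a one-form at level `k`) is `L^{−d}` times the level-`(k+1)` tube sum.** [cite: Balaban1987RG1, (0.11) p.253] -/
theorem segMean_tubeSum {k : ℕ} (hk : k + 1 ≤ P.m + P.K) (a : PBond P 0 → ℝ) (c : PBond P (k + 1)) :
    segMean (tubeSum k a) c = ((P.L : ℝ) ^ P.d)⁻¹ * tubeSum (k + 1) a c := by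
  rw [segMean_eq, tubeSum_succ hk]
  congr 1
  refine Finset.sum_congr rfl fun r _ => ?_
  rw [runSum, Finset.sum_range]

/-- **★★ THE `k`-FOLD (0.4) LINEAR AVERAGE IN CLOSED FORM**: for every finest one-form `a` there is a site function `Φ` on `T^{(k)}` with
`linAvgIter k a = (L^k)^{−d}·tubeSum k a − cobd Φ` (standing range `k ≤ m + K`).  [cite: Balaban1987RG1, (0.4)+(0.11) p.253] -/
theorem linAvgIter_eq_tubeSum_sub_cobd : ∀ {k : ℕ}, k ≤ P.m + P.K → ∀ a : PBond P 0 → ℝ,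
    ∃ Φ : Site P k → ℝ, ∀ c : PBond P k, linAvgIter k a c = (((P.L : ℝ) ^ k) ^ P.d)⁻¹ * tubeSum k a c - cobd Φ c
  | 0, _, a => ⟨fun _ => 0, fun c => by simp [linAvgIter, tubeSum_zero, cobd]⟩
  | k + 1, hk, a => by
    obtain ⟨Φ, hΦ⟩ := linAvgIter_eq_tubeSum_sub_cobd (Nat.le_of_succ_le hk) a
    refine ⟨fun y => blockMean Φ y + stairMean (linAvgIter k a) y, fun c => ?_⟩
    have hfun : linAvgIter k a = (fun b => (((P.L : ℝ) ^ k) ^ P.d)⁻¹ * tubeSum k a b) - cobd Φ := by funext b; rw [hΦ b]; rfl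
    rw [linAvgIter_succ, linAvg04_eq, hfun, segMean_sub_cobd, segMean_smul, segMean_tubeSum hk, ← hfun]
    simp only [cobd, pow_succ, mul_pow, mul_inv]
    ring

/-- **★ EXACT TUBE AVERAGES GIVE EXACT (0.4) AVERAGES AFTER A FINEST GAUGE SHIFT**: if `(L^k)^{−d}·tubeSum k a = A` on a set of level-`k` bonds, then for the `Φ` of the closed form,
`a′ := a + cobd (Φ ∘ coarsen k)` has `linAvgIter k a′ = A` on those bonds and the same curls (`coarsen k ∘ toFine k = id` in the standing range).
[cite: Balaban1987RG1, (0.4)+(0.11) p.253] -/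
theorem linAvgIter_gaugeFix {k : ℕ} (a : PBond P 0 → ℝ) (Φ : Site P k → ℝ)
    (hΦ : ∀ c : PBond P k, linAvgIter k a c = (((P.L : ℝ) ^ k) ^ P.d)⁻¹ * tubeSum k a c - cobd Φ c)
    (ψ : Site P 0 → ℝ) (hψ : ∀ y : Site P k, ψ (toFine k y) = Φ y) (c : PBond P k) :
    linAvgIter k (a + cobd ψ) c = (((P.L : ℝ) ^ k) ^ P.d)⁻¹ * tubeSum k a c := by
  rw [linAvgIter_add, linAvgIter_cobd, Pi.add_apply, hΦ c]
  simp only [cobd, Function.comp, hψ, PBond.tgt]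
  ring

end Summit.QuantumFields.YangMills.Theorems.AbelianEML

end
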